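import Literature.Probability.RandomPlanarGeometry.RadialBesselSLE
import Mathlib.Analysis.SpecificLimits.Basic
import HarnessLib

/-!
# The lifetime of the radial Bessel process of SLE_κ: tails, finiteness, and `E[e^{λT}; Y_T = 2π] = sin(θ/4)^q`

Topic `Probability/RandomPlanarGeometry`; theorems, with auxiliary definitions (`sleLifetime`,
`sleLifetimeReal`, `sleExitsTop`, `sleExitLevelReal`, `sleExitLevelValue`), sequel of
`RadialBesselSLE`. For `κ > 4`, `q = (κ - 4)/κ`, `λ = (κ² - 16)/(32κ)` (LSW (2002), (1.1), p. 7)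
and a start `θ ∈ (0, 2π)`, let `Y` be the radial Bessel process of SLE_κ,
`dYₜ = cot(Yₜ/2) dt - √κ dBₜ` (LSW (2.11); Lawler (2005), (1.16), (6.13)), `T` its lifetime (the
swallowing time of `e^{iθ}` by radial SLE_κ, `RadialBesselExit.lifetime`), `σₙ` the exit times of
the truncation levels, and `{Y_T = 2π}` the event that `Y` leaves `(0, 2π)` through `2π`
(`ExitsTop`; LSW's `ν = 1`, p. 5: for radial SLE₆ coupled to the percolation scaling limit,
`ν = 1` iff the component of `0` cut off at the disconnection time `T` of `e^{iθ}` is bounded by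
the right-hand side of the path and `A_θ`, and then the conformal radius is `𝔯(θ) = r' e^{-T}`,
(2.8)). We prove:

* `measureReal_lt_sleExitLevel_le`, `measureReal_lt_sleLifetime_le` — **uniform exponential
  tails** `P[σₙ > t], P[T > t] ≤ ((c₀+1)/c₀) e^{-μ₀ t}` with the rate `μ₀ = tailRate κ > λ` of the
  positive supersolution `φ = c₀ + sin(·/2)^p` (`RadialBesselODE`), by optional stopping of the
  supermartingale `e^{μ₀(t∧σₙ)} φ(Y_{t∧σₙ})`: `c₀ e^{μ₀t} P[t < σₙ] ≤ E[…] ≤ φ(θ) ≤ c₀ + 1`;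
* `ae_sleLifetime_lt_top` — **`T < ∞` a.s.** (Lawler (2005), Lemma 1.27: "If `a < 1/2`, w.p.1
  `T < ∞`", `a = 2/κ`; §6.4: "`T_x < ∞` if `κ > 4`");
* `integrable_exp_mul_sleLifetimeReal` — **exponential moments `E[e^{rT}] < ∞` for `r < μ₀`**,
  in particular for `r = λ` (`integrable_exp_lswLambda_mul_sleLifetimeReal`);
* `integral_exp_lswLambda_mul_indicator_exitsTop` — **the one-arm identity**

    `E[e^{λ T} ; Y_T = 2π] = sin(θ/4)^q`,

  the probabilistic content of LSW's observation that `H(θ, t) = sin(θ/4)^q e^{-λt}` solves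
  `Λ H = 0`, `H(0, t) = 0`, `∂_θ H(2π, t) = 0` (p. 7; "(but other justifications are also
  possible)"): the stopped eigenfunction martingale (`integral_expClock_mul_eq_self`, Lawler
  (2005), Lemma 1.31 pattern), `t → ∞` by dominated convergence (`σₙ < ∞` a.s., domination by
  `e^{λT}`), then `n → ∞` (`σₙ ↑ T`; `H(Y_{σₙ}) → 𝟙_{Y_T = 2π}` by the exit dichotomy of
  `RadialBesselExit`, dominated again by `e^{λT}`). For `κ = 6`:
  `E[e^{5T/48}; Y_T = 2π] = sin(θ/4)^{1/3}` (`integral_exp_mul_indicator_exitsTop_six`).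

## References

* G. F. Lawler, O. Schramm, W. Werner, *One-arm exponent for critical 2D percolation*, Electron.
  J. Probab. 7 (2002), no. 2: (1.1), §2 (2.7)–(2.11), p. 5 (`ν`, `Y_T`), p. 7 (`H`).
  [LawlerSchrammWernerEJP2002]
* G. F. Lawler, *Conformally Invariant Processes in the Plane*, AMS (2005), §1.11: (1.16),
  Lemma 1.27, Lemma 1.28, Prop. 1.30, Lemma 1.31, (1.21)–(1.22); §6.4. [Lawler2005]
-/

noncomputable section

open MeasureTheory ProbabilityTheory Filter Topology Set
open scoped NNReal ENNReal

namespace Literature.Probability.RandomPlanarGeometry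

namespace RadialLoewner

open Literature.Probability.Process Literature.Analysis.FunctionSpaces
open Literature.Probability.Percolation (lswQ lswLambda lswLambda_pos lswQ_pos)

/-! ### The lifetime of the SLE_κ radial Bessel process -/

/-- **The lifetime `T` of the radial Bessel process of SLE_κ started at `θ`** (the swallowing time
of `e^{iθ}` by radial SLE_κ; LSW's `T`, p. 5), `= ⨆ₙ σₙ`, valued in `WithTop ℝ≥0`.
[cite: LawlerSchrammWernerEJP2002, §2 p. 5] -/
abbrev sleLifetime (κ : ℝ≥0) (θ : ℝ) : (ℝ≥0 → ℝ) → WithTop ℝ≥0 :=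
  lifetime (sleDriving κ) (continuous_sleDriving' κ) θ

/-- The lifetime read in `ℝ` (`WithTop.untopA`; junk on the null event `{T = ∞}`). [folklore] -/
def sleLifetimeReal (κ : ℝ≥0) (θ : ℝ) (ω : ℝ≥0 → ℝ) : ℝ :=
  ((sleLifetime κ θ ω).untopA : ℝ≥0)

variable {κ : ℝ≥0} {θ : ℝ} {n : ℕ}

/-- `T` is a stopping time of the raw Brownian filtration. [folklore] -/
theorem isStoppingTime_sleLifetime (κ : ℝ≥0) (θ : ℝ) :
    IsStoppingTime brownianFiltration (sleLifetime κ θ) :=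
  isStoppingTime_lifetime (continuous_sleDriving' κ) (measurable_sleDriving_filtration κ) θ

/-- `T` is measurable. [folklore] -/
theorem measurable_sleLifetime (κ : ℝ≥0) (θ : ℝ) : Measurable (sleLifetime κ θ) :=
  (isStoppingTime_sleLifetime κ θ).measurable'

/-- The real lifetime is measurable. [folklore] -/
theorem measurable_sleLifetimeReal (κ : ℝ≥0) (θ : ℝ) : Measurable (sleLifetimeReal κ θ) :=
  (measurable_sleLifetime κ θ).untopA.coe_nnreal_real

/-- The real lifetime is nonnegative. [folklore] -/
theorem sleLifetimeReal_nonneg (κ : ℝ≥0) (θ : ℝ) (ω : ℝ≥0 → ℝ) : 0 ≤ sleLifetimeReal κ θ ω :=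
  NNReal.coe_nonneg _

/-- On `{T = s}` the real lifetime is `s`. [folklore] -/
theorem sleLifetimeReal_of_eq_coe {ω : ℝ≥0 → ℝ} {s : ℝ≥0} (h : sleLifetime κ θ ω = s) :
    sleLifetimeReal κ θ ω = s := by
  rw [sleLifetimeReal, h, WithTop.untopA_eq_untop WithTop.coe_ne_top, WithTop.untop_coe]

/-- The event `{t < σₙ}` is measurable. [folklore] -/
theorem measurableSet_lt_sleExitLevel (κ : ℝ≥0) (n : ℕ) (θ : ℝ) (t : ℝ≥0) :
    MeasurableSet {ω | (t : WithTop ℝ≥0) < sleExitLevel κ n θ ω} := by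
  have h : {ω | (t : WithTop ℝ≥0) < sleExitLevel κ n θ ω} = {ω | sleExitLevel κ n θ ω ≤ t}ᶜ := by
    ext ω; simp
  rw [h]
  exact brownianFiltration.le t _ ((isStoppingTime_sleExitLevel κ n θ) t).compl

/-- The event `{t < T}` is measurable. [folklore] -/
theorem measurableSet_lt_sleLifetime (κ : ℝ≥0) (θ : ℝ) (t : ℝ≥0) :
    MeasurableSet {ω | (t : WithTop ℝ≥0) < sleLifetime κ θ ω} :=
  measurableSet_lt (measurable_const) (measurable_sleLifetime κ θ)

/-- The event `{T = ∞}` is measurable. [folklore] -/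
theorem measurableSet_sleLifetime_eq_top (κ : ℝ≥0) (θ : ℝ) :
    MeasurableSet {ω | sleLifetime κ θ ω = ⊤} :=
  (isStoppingTime_sleLifetime κ θ).measurableSet_eq_top

/-! ### Global `C²` versions of the supersolution -/

/-- `[2δₙ, 2π - 2δₙ] ⊆ (δₙ, 2π - δₙ)`. [folklore] -/
theorem Icc_level_subset_Ioo_level (n : ℕ) :
    Icc (2 * level n) (2 * Real.pi - 2 * level n) ⊆ Ioo (level n) (2 * Real.pi - level n) := by
  intro y hy; have := level_pos n; exact ⟨by linarith [hy.1], by linarith [hy.2]⟩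

/-- `[2δₙ, 2π - 2δₙ] ⊆ (0, 2π)`. [folklore] -/
theorem Icc_level_subset_Ioo (n : ℕ) :
    Icc (2 * level n) (2 * Real.pi - 2 * level n) ⊆ Ioo 0 (2 * Real.pi) := by
  intro y hy; have := level_pos n; exact ⟨by linarith [hy.1], by linarith [hy.2]⟩

/-- `[2δₙ, 2π - 2δₙ] ⊆ [0, 2π]`. [folklore] -/
theorem Icc_level_subset_Icc (n : ℕ) :
    Icc (2 * level n) (2 * Real.pi - 2 * level n) ⊆ Icc 0 (2 * Real.pi) :=
  (Icc_level_subset_Ioo n).trans Ioo_subset_Icc_self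

/-- `δₙ < π`. [folklore] -/
theorem level_lt_pi (n : ℕ) : level n < Real.pi := by
  linarith [level_le_one n, Real.pi_gt_three]

/-- A global `C²` function agreeing with the supersolution `φ` near `[2δₙ, 2π - 2δₙ]`.
[folklore] -/
theorem exists_contDiff_tailFn (κ : ℝ≥0) (n : ℕ) :
    ∃ F : ℝ → ℝ, ContDiff ℝ 2 F ∧ ∀ y ∈ Ioo (level n) (2 * Real.pi - level n), F =ᶠ[𝓝 y] tailFn κ :=
  exists_contDiff_eventuallyEq (contDiffOn_tailFn κ) (level_pos n) (level_lt_pi n)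

/-! ### Uniform exponential tails of the exit times -/

/-- **Exponential tail of the level-`n` exit time** (`κ > 4`, start inside the level-`n`
interval): `P[t < σₙ] ≤ ((c₀+1)/c₀) e^{-μ₀ t}`, uniformly in `n` and `θ`. Proof: optional stopping
of the supermartingale `e^{μ₀(t∧σₙ)} φ(Y_{t∧σₙ})`, `φ = c₀ + sin(·/2)^p ≥ c₀ > 0`, `Λ_{μ₀} φ ≤ 0`:
`c₀ e^{μ₀ t} P[t < σₙ] ≤ E[e^{μ₀(t∧σₙ)} φ(Y_{t∧σₙ})] ≤ φ(θ) ≤ c₀ + 1`. (Compare Lawler (2005),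
Lemma 1.28 / (1.21): the exact decay rate of `P[T > t]` is the Dirichlet eigenvalue
`(κ - 4)/8 > μ₀`.) [cite: Lawler2005, §1.11 Lemma 1.28] -/
theorem measureReal_lt_sleExitLevel_le (hκ : 4 < κ)
    (hθn : θ ∈ Ioo (2 * level n) (2 * Real.pi - 2 * level n)) (t : ℝ≥0) :
    preWienerMeasure.real {ω | (t : WithTop ℝ≥0) < sleExitLevel κ n θ ω} ≤
      (tailConst κ + 1) / tailConst κ * Real.exp (-(tailRate κ * t)) := by
  haveI := isProbabilityMeasure_preWienerMeasure'
  obtain ⟨F, hF, hFeq⟩ := exists_contDiff_tailFn κ n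
  set μ₀ := tailRate κ with hμ₀
  set c₀ := tailConst κ with hc₀
  have hc₀pos : 0 < c₀ := tailConst_pos hκ
  have hFval : ∀ y ∈ Icc (2 * level n) (2 * Real.pi - 2 * level n), F y = tailFn κ y :=
    fun y hy ↦ (hFeq y (Icc_level_subset_Ioo_level n hy)).eq_of_nhds
  have hgen : ∀ y ∈ Icc (2 * level n) (2 * Real.pi - 2 * level n), expGenerator κ μ₀ F y ≤ 0 := by
    intro y hy
    rw [expGenerator_congr (hFeq y (Icc_level_subset_Ioo_level n hy))]
    exact expGenerator_tailFn_nonpos hκ (Icc_level_subset_Ioo n hy)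
  have hup := integral_expClock_mul_le_self hθn hF hgen t
  -- `F θ = φ θ ≤ c₀ + 1`
  have hθmem : θ ∈ Icc (2 * level n) (2 * Real.pi - 2 * level n) := ⟨hθn.1.le, hθn.2.le⟩
  have hFθ : F θ ≤ c₀ + 1 := by
    rw [hFval θ hθmem]; exact tailFn_le hκ (Icc_level_subset_Icc n hθmem)
  -- lower bound by the indicator of `{t < σₙ}`
  set A := {ω : ℝ≥0 → ℝ | (t : WithTop ℝ≥0) < sleExitLevel κ n θ ω} with hA
  have hAm : MeasurableSet A := measurableSet_lt_sleExitLevel κ n θ t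
  have hVmem : ∀ ω, stoppedProcess (sleArgLevel κ n θ) (sleExitLevel κ n θ) t ω ∈
      Icc (2 * level n) (2 * Real.pi - 2 * level n) := stoppedProcess_sleArgLevel_mem_Icc hθn t
  have hFV : ∀ ω, c₀ ≤ F (stoppedProcess (sleArgLevel κ n θ) (sleExitLevel κ n θ) t ω) := fun ω ↦ by
    rw [hFval _ (hVmem ω)]; exact tailConst_le_tailFn κ (Icc_level_subset_Icc n (hVmem ω))
  have hlow : ∫ ω, A.indicator (fun _ ↦ c₀ * Real.exp (μ₀ * t)) ω ∂preWienerMeasure ≤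
      ∫ ω, expClock κ n θ μ₀ t ω * F (stoppedProcess (sleArgLevel κ n θ) (sleExitLevel κ n θ) t ω)
        ∂preWienerMeasure := by
    refine integral_mono ((integrable_const _).indicator hAm) (integrable_expClock_mul hθn hF μ₀ t)
      fun ω ↦ ?_
    by_cases hω : ω ∈ A
    · rw [indicator_of_mem hω]
      have hclock : expClock κ n θ μ₀ t ω = Real.exp (μ₀ * t) := by
        have hlt : (t : WithTop ℝ≥0) < sleExitLevel κ n θ ω := hω
        rw [expClock_apply, min_eq_left hlt.le, untopA_coe]
      rw [hclock, mul_comm]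
      exact mul_le_mul_of_nonneg_left (hFV ω) (Real.exp_pos _).le
    · rw [indicator_of_notMem hω]
      exact mul_nonneg (expClock_pos μ₀ t ω).le (hc₀pos.le.trans (hFV ω))
  rw [integral_indicator_const _ hAm, smul_eq_mul] at hlow
  -- combine
  have hkey : preWienerMeasure.real A * (c₀ * Real.exp (μ₀ * t)) ≤ c₀ + 1 := hlow.trans (hup.trans hFθ)
  have hexp : 0 < Real.exp (μ₀ * t) := Real.exp_pos _
  rw [Real.exp_neg, show (c₀ + 1) / c₀ * (Real.exp (μ₀ * t))⁻¹ = (c₀ + 1) / (c₀ * Real.exp (μ₀ * t)) by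
    field_simp, le_div_iff₀ (by positivity)]
  exact hkey

/-- `{t < T} = ⋃ₙ {t < σₙ}`. [folklore] -/
theorem setOf_lt_sleLifetime_eq_iUnion (κ : ℝ≥0) (θ : ℝ) (t : ℝ≥0) :
    {ω | (t : WithTop ℝ≥0) < sleLifetime κ θ ω} = ⋃ n : ℕ, {ω | (t : WithTop ℝ≥0) < sleExitLevel κ n θ ω} := by
  ext ω; simp only [mem_setOf_eq, sleLifetime, lifetime, lt_iSup_iff, mem_iUnion]

/-- **Exponential tail of the lifetime**: `P[t < T] ≤ ((c₀+1)/c₀) e^{-μ₀ t}` (`κ > 4`, any start: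
for `θ ∉ (0, 2π)` all `σₙ` vanish and `T = 0`; increasing union of the level events).
[cite: Lawler2005, §1.11 Lemma 1.28] -/
theorem measureReal_lt_sleLifetime_le (hκ : 4 < κ) (t : ℝ≥0) :
    preWienerMeasure.real {ω | (t : WithTop ℝ≥0) < sleLifetime κ θ ω} ≤
      (tailConst κ + 1) / tailConst κ * Real.exp (-(tailRate κ * t)) := by
  haveI := isProbabilityMeasure_preWienerMeasure'
  set K := (tailConst κ + 1) / tailConst κ * Real.exp (-(tailRate κ * t)) with hK
  have hK0 : 0 ≤ K := by have := tailConst_pos hκ; positivity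
  set A : ℕ → Set (ℝ≥0 → ℝ) := fun n ↦ {ω | (t : WithTop ℝ≥0) < sleExitLevel κ n θ ω} with hA
  have hmono : Monotone A := fun n m hnm ω (hω : (t : WithTop ℝ≥0) < _) ↦
    hω.trans_le (exitLevel_mono (continuous_sleDriving' κ) θ ω hnm)
  have hbound : ∀ n, preWienerMeasure (A n) ≤ ENNReal.ofReal K := by
    intro n
    by_cases hθn : θ ∈ Ioo (2 * level n) (2 * Real.pi - 2 * level n)
    · rw [← ofReal_measureReal (measure_ne_top _ _)]
      exact ENNReal.ofReal_le_ofReal (measureReal_lt_sleExitLevel_le hκ hθn t)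
    · have hempty : A n = ∅ := by
        refine eq_empty_of_forall_notMem fun ω (hω : (t : WithTop ℝ≥0) < _) ↦ ?_
        have h0 : sleExitLevel κ n θ ω = 0 := exitLevel_eq_zero_of_not_mem (continuous_sleDriving' κ) hθn ω
        rw [h0] at hω
        exact not_lt_bot hω
      rw [hempty, measure_empty]; exact bot_le
  have hunion : preWienerMeasure (⋃ n, A n) ≤ ENNReal.ofReal K := by
    rw [hmono.measure_iUnion]
    exact iSup_le hbound
  rw [setOf_lt_sleLifetime_eq_iUnion]
  exact ENNReal.toReal_le_of_le_ofReal hK0 hunion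

/-- **The lifetime is almost surely finite** (`κ > 4`): `P[T = ∞] ≤ P[k < T] → 0`.
Lawler (2005), Lemma 1.27 ("If `a < 1/2`, w.p.1 `T < ∞`"; `a = 2/κ`) and §6.4 ("`T_x < ∞` if
`κ > 4`"). [cite: Lawler2005, §1.11 Lemma 1.27] -/
theorem ae_sleLifetime_lt_top (hκ : 4 < κ) :
    ∀ᵐ ω ∂preWienerMeasure, sleLifetime κ θ ω < ⊤ := by
  haveI := isProbabilityMeasure_preWienerMeasure'
  set N := {ω : ℝ≥0 → ℝ | sleLifetime κ θ ω = ⊤} with hN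
  have hNm : MeasurableSet N := measurableSet_sleLifetime_eq_top κ θ
  set C := (tailConst κ + 1) / tailConst κ with hC
  have hle : ∀ k : ℕ, preWienerMeasure.real N ≤ C * Real.exp (-(tailRate κ * k)) := by
    intro k
    refine le_trans (measureReal_mono (fun ω (hω : sleLifetime κ θ ω = ⊤) ↦ ?_))
      (measureReal_lt_sleLifetime_le hκ (k : ℝ≥0))
    change ((k : ℝ≥0) : WithTop ℝ≥0) < sleLifetime κ θ ω
    rw [hω]; exact WithTop.coe_lt_top _
  have hlim : Tendsto (fun k : ℕ ↦ C * Real.exp (-(tailRate κ * k))) atTop (𝓝 0) := by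
    rw [show (0 : ℝ) = C * 0 by ring]
    refine tendsto_const_nhds.mul ?_
    have h1 : Tendsto (fun k : ℕ ↦ tailRate κ * (k : ℝ)) atTop atTop :=
      tendsto_natCast_atTop_atTop.const_mul_atTop (tailRate_pos hκ)
    exact Real.tendsto_exp_atBot.comp (tendsto_neg_atTop_atBot.comp h1)
  have hN0 : preWienerMeasure.real N = 0 :=
    le_antisymm (ge_of_tendsto' hlim hle) measureReal_nonneg
  rw [ae_iff]
  have : {ω : ℝ≥0 → ℝ | ¬ sleLifetime κ θ ω < ⊤} = N := by ext ω; simp [hN]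
  rw [this]
  exact (measureReal_eq_zero_iff (measure_ne_top _ _)).1 hN0

/-! ### Exponential moments of the lifetime -/

/-- **Layer bound**: `e^{r T} ≤ 1 + Σₖ e^{r(k+1)} 𝟙_{k < T}` (`r ≥ 0`; in `ℝ≥0∞`). [folklore] -/
theorem ofReal_exp_mul_le_tsum {r x : ℝ} (hr : 0 ≤ r) (hx : 0 ≤ x) :
    ENNReal.ofReal (Real.exp (r * x)) ≤
      1 + ∑' k : ℕ, ENNReal.ofReal (Real.exp (r * (k + 1))) * {y : ℝ | (k : ℝ) < y}.indicator 1 x := by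
  rcases hx.eq_or_lt with h0 | hpos
  · rw [← h0, mul_zero, Real.exp_zero, ENNReal.ofReal_one]
    exact le_self_add
  · -- `k = ⌈x⌉₊ - 1` satisfies `k < x ≤ k + 1`
    set k := ⌈x⌉₊ - 1 with hk
    have hceil : 1 ≤ ⌈x⌉₊ := Nat.one_le_iff_ne_zero.2 (Nat.ceil_pos.2 hpos).ne'
    have hk1 : (k : ℝ) + 1 = ⌈x⌉₊ := by
      rw [hk, Nat.cast_sub hceil]; push_cast; ring
    have hkx : (k : ℝ) < x := by
      have : k < ⌈x⌉₊ := by omega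
      exact Nat.lt_ceil.1 this
    have hxk : x ≤ k + 1 := by rw [hk1]; exact Nat.le_ceil x
    calc ENNReal.ofReal (Real.exp (r * x))
        ≤ ENNReal.ofReal (Real.exp (r * (k + 1))) * {y : ℝ | (k : ℝ) < y}.indicator 1 x := by
          rw [indicator_of_mem (show x ∈ {y : ℝ | (k : ℝ) < y} from hkx), Pi.one_apply, mul_one]
          exact ENNReal.ofReal_le_ofReal (Real.exp_le_exp.2 (mul_le_mul_of_nonneg_left hxk hr))
      _ ≤ ∑' k : ℕ, ENNReal.ofReal (Real.exp (r * (k + 1))) * {y : ℝ | (k : ℝ) < y}.indicator 1 x :=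
          ENNReal.le_tsum k
      _ ≤ 1 + _ := le_add_self

/-- `{k < T_real} ⊆ {k < T} ∪ {T = ∞}`: the real lifetime exceeds `k` only if the lifetime does
(or on the junk event). [folklore] -/
theorem setOf_lt_sleLifetimeReal_subset (κ : ℝ≥0) (θ : ℝ) (k : ℕ) :
    {ω | (k : ℝ) < sleLifetimeReal κ θ ω} ⊆
      {ω | ((k : ℝ≥0) : WithTop ℝ≥0) < sleLifetime κ θ ω} ∪ {ω | sleLifetime κ θ ω = ⊤} := by
  intro ω hω
  by_cases htop : sleLifetime κ θ ω = ⊤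
  · exact Or.inr htop
  · left
    obtain ⟨s, hs⟩ := WithTop.ne_top_iff_exists.1 htop
    have hreal : sleLifetimeReal κ θ ω = s := sleLifetimeReal_of_eq_coe hs.symm
    change ((k : ℝ≥0) : WithTop ℝ≥0) < sleLifetime κ θ ω
    rw [← hs, WithTop.coe_lt_coe, ← NNReal.coe_lt_coe]
    have : (k : ℝ) < s := by rw [← hreal]; exact hω
    exact_mod_cast this

/-- **`E[e^{r T}] ≤ 1 + ((c₀+1)/c₀) e^{r} Σₖ (e^{r - μ₀})^k < ∞` for `0 ≤ r < μ₀`**: exponential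
moments of the lifetime below the supersolution's rate. [cite: Lawler2005, §1.11 (1.21)–(1.22)] -/
theorem lintegral_exp_mul_sleLifetimeReal_lt_top (hκ : 4 < κ) {r : ℝ} (hr0 : 0 ≤ r)
    (hr : r < tailRate κ) :
    ∫⁻ ω, ENNReal.ofReal (Real.exp (r * sleLifetimeReal κ θ ω)) ∂preWienerMeasure < ∞ := by
  haveI := isProbabilityMeasure_preWienerMeasure'
  set C := (tailConst κ + 1) / tailConst κ with hC
  have hC0 : 0 ≤ C := by have := tailConst_pos hκ; positivity
  set μ₀ := tailRate κ with hμ₀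
  -- the events `{k < T_real}` and their measures
  set A : ℕ → Set (ℝ≥0 → ℝ) := fun k ↦ {ω | (k : ℝ) < sleLifetimeReal κ θ ω} with hA
  have hAm : ∀ k, MeasurableSet (A k) := fun k ↦
    measurableSet_lt measurable_const (measurable_sleLifetimeReal κ θ)
  have hAle : ∀ k : ℕ, preWienerMeasure (A k) ≤ ENNReal.ofReal (C * Real.exp (-(μ₀ * k))) := by
    intro k
    have hnull : preWienerMeasure {ω | sleLifetime κ θ ω = ⊤} = 0 := by
      have h := ae_sleLifetime_lt_top (θ := θ) hκ
      rw [ae_iff] at h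
      convert h using 2
      ext ω; simp
    calc preWienerMeasure (A k)
        ≤ preWienerMeasure ({ω | ((k : ℝ≥0) : WithTop ℝ≥0) < sleLifetime κ θ ω} ∪
            {ω | sleLifetime κ θ ω = ⊤}) := measure_mono (setOf_lt_sleLifetimeReal_subset κ θ k)
      _ ≤ preWienerMeasure {ω | ((k : ℝ≥0) : WithTop ℝ≥0) < sleLifetime κ θ ω} +
            preWienerMeasure {ω | sleLifetime κ θ ω = ⊤} := measure_union_le _ _
      _ = preWienerMeasure {ω | ((k : ℝ≥0) : WithTop ℝ≥0) < sleLifetime κ θ ω} := by rw [hnull, add_zero]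
      _ ≤ ENNReal.ofReal (C * Real.exp (-(μ₀ * k))) := by
          rw [← ofReal_measureReal (measure_ne_top _ _)]
          exact ENNReal.ofReal_le_ofReal (by simpa using measureReal_lt_sleLifetime_le (θ := θ) hκ (k : ℝ≥0))
  -- pointwise layer bound and its integral
  have hpt : ∀ ω, ENNReal.ofReal (Real.exp (r * sleLifetimeReal κ θ ω)) ≤
      1 + ∑' k : ℕ, ENNReal.ofReal (Real.exp (r * (k + 1))) * (A k).indicator 1 ω := by
    intro ω
    have h := ofReal_exp_mul_le_tsum hr0 (sleLifetimeReal_nonneg κ θ ω)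
    have hind : ∀ k : ℕ, (A k).indicator (1 : (ℝ≥0 → ℝ) → ℝ≥0∞) ω =
        {y : ℝ | (k : ℝ) < y}.indicator 1 (sleLifetimeReal κ θ ω) := by
      intro k; simp only [hA, Set.indicator_apply, mem_setOf_eq, Pi.one_apply]
    simp_rw [hind]; exact h
  have hmeas : ∀ k : ℕ, Measurable fun ω ↦ ENNReal.ofReal (Real.exp (r * (k + 1))) * (A k).indicator 1 ω :=
    fun k ↦ measurable_const.mul (measurable_one.indicator (hAm k))
  calc ∫⁻ ω, ENNReal.ofReal (Real.exp (r * sleLifetimeReal κ θ ω)) ∂preWienerMeasure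
      ≤ ∫⁻ ω, (1 + ∑' k : ℕ, ENNReal.ofReal (Real.exp (r * (k + 1))) * (A k).indicator 1 ω)
          ∂preWienerMeasure := lintegral_mono hpt
    _ = 1 + ∑' k : ℕ, ENNReal.ofReal (Real.exp (r * (k + 1))) * preWienerMeasure (A k) := by
        rw [lintegral_add_left measurable_const, lintegral_const, measure_univ, mul_one,
          lintegral_tsum fun k ↦ (hmeas k).aemeasurable]
        congr 1
        refine tsum_congr fun k ↦ ?_
        rw [lintegral_const_mul _ (measurable_one.indicator (hAm k)), lintegral_indicator_one (hAm k)]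
    _ ≤ 1 + ∑' k : ℕ, ENNReal.ofReal (Real.exp (r * (k + 1))) * ENNReal.ofReal (C * Real.exp (-(μ₀ * k))) := by
        gcongr with k
        exact hAle k
    _ = 1 + ∑' k : ℕ, ENNReal.ofReal (C * Real.exp r) * ENNReal.ofReal (Real.exp (r - μ₀)) ^ k := by
        congr 1
        refine tsum_congr fun k ↦ ?_
        rw [← ENNReal.ofReal_mul (Real.exp_pos _).le, ← ENNReal.ofReal_pow (Real.exp_pos _).le,
          ← ENNReal.ofReal_mul (by positivity)]
        congr 1
        rw [← Real.exp_nat_mul]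
        have hexp : r * (k + 1) + -(μ₀ * k) = r + k * (r - μ₀) := by ring
        calc Real.exp (r * (k + 1)) * (C * Real.exp (-(μ₀ * k)))
            = C * Real.exp (r * (k + 1) + -(μ₀ * k)) := by rw [Real.exp_add]; ring
          _ = C * Real.exp (r + k * (r - μ₀)) := by rw [hexp]
          _ = C * Real.exp r * Real.exp (k * (r - μ₀)) := by rw [Real.exp_add]; ring
    _ < ∞ := by
        rw [ENNReal.tsum_mul_left, ENNReal.tsum_geometric]
        refine ENNReal.add_lt_top.2 ⟨ENNReal.one_lt_top, ENNReal.mul_lt_top ENNReal.ofReal_lt_top ?_⟩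
        rw [ENNReal.inv_lt_top, tsub_pos_iff_lt]
        exact ENNReal.ofReal_lt_one.2 (Real.exp_lt_one_iff.2 (by linarith))

/-- **Integrability of `e^{r T}` for `0 ≤ r < μ₀`.** [cite: Lawler2005, §1.11 (1.21)–(1.22)] -/
theorem integrable_exp_mul_sleLifetimeReal (hκ : 4 < κ) {r : ℝ} (hr0 : 0 ≤ r) (hr : r < tailRate κ) :
    Integrable (fun ω ↦ Real.exp (r * sleLifetimeReal κ θ ω)) preWienerMeasure := by
  have hm : Measurable fun ω ↦ Real.exp (r * sleLifetimeReal κ θ ω) :=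
    Real.measurable_exp.comp (measurable_const.mul (measurable_sleLifetimeReal κ θ))
  refine ⟨hm.aestronglyMeasurable, ?_⟩
  rw [hasFiniteIntegral_iff_ofReal (ae_of_all _ fun ω ↦ (Real.exp_pos _).le)]
  exact lintegral_exp_mul_sleLifetimeReal_lt_top hκ hr0 hr

/-- **Integrability of `e^{λ T}`, `λ = (κ² - 16)/(32κ)`** (`λ < μ₀`, `lswLambda_lt_tailRate`): the
domination used in the one-arm identity. [cite: LawlerSchrammWernerEJP2002, §2 p. 7] -/
theorem integrable_exp_lswLambda_mul_sleLifetimeReal (hκ : 4 < κ) :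
    Integrable (fun ω ↦ Real.exp (lswLambda κ * sleLifetimeReal κ θ ω)) preWienerMeasure :=
  integrable_exp_mul_sleLifetimeReal hκ (lswLambda_pos (by exact_mod_cast hκ)).le
    (lswLambda_lt_tailRate hκ)


/-! ### The exit event, the level exit values and clocks -/

/-- **The event `{Y_T = 2π}`** that the radial Bessel process of SLE_κ from `θ` leaves `(0, 2π)`
through `2π` (LSW's `ν = 1`, p. 5), as a set of Brownian paths. [cite: LawlerSchrammWernerEJP2002, §2 p. 5] -/
def sleExitsTop (κ : ℝ≥0) (θ : ℝ) : Set (ℝ≥0 → ℝ) :=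
  {ω | ExitsTop (sleDriving κ) (continuous_sleDriving' κ) θ ω}

/-- The level-`n` exit time read in `ℝ` (junk on `{σₙ = ∞}`). [folklore] -/
def sleExitLevelReal (κ : ℝ≥0) (n : ℕ) (θ : ℝ) (ω : ℝ≥0 → ℝ) : ℝ :=
  ((sleExitLevel κ n θ ω).untopA : ℝ≥0)

/-- The level-`n` exit value `Y^{δₙ}(σₙ)` (junk `Y^{δₙ}(untopA ⊤)` on `{σₙ = ∞}`). [folklore] -/
def sleExitLevelValue (κ : ℝ≥0) (n : ℕ) (θ : ℝ) (ω : ℝ≥0 → ℝ) : ℝ :=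
  sleArgLevel κ n θ (sleExitLevel κ n θ ω).untopA ω

/-- `{Y_T = 2π}` is measurable. [folklore] -/
theorem measurableSet_sleExitsTop (κ : ℝ≥0) (θ : ℝ) : MeasurableSet (sleExitsTop κ θ) :=
  measurableSet_exitsTop (continuous_sleDriving' κ) (measurable_sleDriving_filtration κ) θ

/-- The real level exit time is measurable. [folklore] -/
theorem measurable_sleExitLevelReal (κ : ℝ≥0) (n : ℕ) (θ : ℝ) :
    Measurable (sleExitLevelReal κ n θ) :=
  ((isStoppingTime_sleExitLevel κ n θ).measurable').untopA.coe_nnreal_real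

/-- On `{σₙ = s}` the real exit time is `s`. [folklore] -/
theorem sleExitLevelReal_of_eq_coe {ω : ℝ≥0 → ℝ} {s : ℝ≥0} (h : sleExitLevel κ n θ ω = s) :
    sleExitLevelReal κ n θ ω = s := by
  rw [sleExitLevelReal, h, WithTop.untopA_eq_untop WithTop.coe_ne_top, WithTop.untop_coe]

/-- On `{σₙ = s}` the exit value is `Y^{δₙ}(s)`. [folklore] -/
theorem sleExitLevelValue_of_eq_coe {ω : ℝ≥0 → ℝ} {s : ℝ≥0} (h : sleExitLevel κ n θ ω = s) :
    sleExitLevelValue κ n θ ω = sleArgLevel κ n θ s ω := by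
  rw [sleExitLevelValue, h, WithTop.untopA_eq_untop WithTop.coe_ne_top, WithTop.untop_coe]

/-- The exit value is an endpoint: `Y^{δₙ}(σₙ) ∈ {2δₙ, 2π - 2δₙ}` (finite `σₙ`, start inside).
[folklore] -/
theorem sleExitLevelValue_eq_or (hθn : θ ∈ Ioo (2 * level n) (2 * Real.pi - 2 * level n))
    {ω : ℝ≥0 → ℝ} {s : ℝ≥0} (h : sleExitLevel κ n θ ω = s) :
    sleExitLevelValue κ n θ ω = 2 * level n ∨ sleExitLevelValue κ n θ ω = 2 * Real.pi - 2 * level n := by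
  rw [sleExitLevelValue_of_eq_coe h]
  exact argTrunc_truncExit_eq_or (continuous_sleDriving' κ) (level_pos n) (level_le n) hθn ω h

/-- The exit value lies in `[0, 2π]` (finite `σₙ`, start inside). [folklore] -/
theorem sleExitLevelValue_mem_Icc (hθn : θ ∈ Ioo (2 * level n) (2 * Real.pi - 2 * level n))
    {ω : ℝ≥0 → ℝ} {s : ℝ≥0} (h : sleExitLevel κ n θ ω = s) :
    sleExitLevelValue κ n θ ω ∈ Icc 0 (2 * Real.pi) := by
  have := level_pos n; have := level_le_one n
  rcases sleExitLevelValue_eq_or hθn h with h' | h' <;> rw [h'] <;>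
    exact ⟨by nlinarith [Real.pi_gt_three], by nlinarith [Real.pi_gt_three]⟩

/-- `TopAt n` through the exit value. [folklore] -/
theorem topAt_iff_sleExitLevelValue {ω : ℝ≥0 → ℝ} {s : ℝ≥0} (h : sleExitLevel κ n θ ω = s) :
    TopAt (sleDriving κ) (continuous_sleDriving' κ) n θ ω ↔
      sleExitLevelValue κ n θ ω = 2 * Real.pi - 2 * level n := by
  rw [sleExitLevelValue_of_eq_coe h]
  constructor
  · rintro ⟨t, ht, hyt⟩
    have : t = s := WithTop.coe_injective (ht.symm.trans h)
    subst this; exact hyt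
  · intro hy; exact ⟨s, h, hy⟩

/-- `BotAt n` through the exit value. [folklore] -/
theorem botAt_iff_sleExitLevelValue {ω : ℝ≥0 → ℝ} {s : ℝ≥0} (h : sleExitLevel κ n θ ω = s) :
    BotAt (sleDriving κ) (continuous_sleDriving' κ) n θ ω ↔ sleExitLevelValue κ n θ ω = 2 * level n := by
  rw [sleExitLevelValue_of_eq_coe h]
  constructor
  · rintro ⟨t, ht, hyt⟩
    have : t = s := WithTop.coe_injective (ht.symm.trans h)
    subst this; exact hyt
  · intro hy; exact ⟨s, h, hy⟩

/-- **`σₙ < ∞` a.s.** (`σₙ ≤ T < ∞` a.s.). [folklore] -/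
theorem ae_sleExitLevel_lt_top (hκ : 4 < κ) (n : ℕ) (θ : ℝ) :
    ∀ᵐ ω ∂preWienerMeasure, sleExitLevel κ n θ ω < ⊤ := by
  filter_upwards [ae_sleLifetime_lt_top (θ := θ) hκ] with ω hω
  exact (exitLevel_le_lifetime (continuous_sleDriving' κ) n θ ω).trans_lt hω

/-- After a finite exit time the stopped flow is eventually (in `k : ℕ`) the exit value. [folklore] -/
theorem eventually_stoppedProcess_eq_sleExitLevelValue {ω : ℝ≥0 → ℝ} {s : ℝ≥0}
    (h : sleExitLevel κ n θ ω = s) :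
    ∀ᶠ k : ℕ in atTop, stoppedProcess (sleArgLevel κ n θ) (sleExitLevel κ n θ) k ω =
      sleExitLevelValue κ n θ ω := by
  obtain ⟨N, hN⟩ := exists_nat_ge (s : ℝ)
  filter_upwards [eventually_ge_atTop N] with k hk
  have hsk : s ≤ (k : ℝ≥0) := by
    rw [← NNReal.coe_le_coe]; push_cast; exact hN.trans (by exact_mod_cast hk)
  rw [stoppedProcess_eq_of_ge (show sleExitLevel κ n θ ω ≤ (k : ℝ≥0) by
    rw [h]; exact_mod_cast hsk)]
  rfl

/-- After a finite exit time the exponential weight is eventually `e^{μ σₙ}`. [folklore] -/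
theorem eventually_expClock_eq {ω : ℝ≥0 → ℝ} {s : ℝ≥0} (h : sleExitLevel κ n θ ω = s) (μ : ℝ) :
    ∀ᶠ k : ℕ in atTop, expClock κ n θ μ k ω = Real.exp (μ * sleExitLevelReal κ n θ ω) := by
  obtain ⟨N, hN⟩ := exists_nat_ge (s : ℝ)
  filter_upwards [eventually_ge_atTop N] with k hk
  have hsk : s ≤ (k : ℝ≥0) := by
    rw [← NNReal.coe_le_coe]; push_cast; exact hN.trans (by exact_mod_cast hk)
  rw [expClock_apply, untopA_min_of_coe_le _ h hsk, sleExitLevelReal_of_eq_coe h]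

/-- `e^{μ(k ∧ σₙ)} ≤ e^{μ σₙ}` for `μ ≥ 0` and finite `σₙ`. [folklore] -/
theorem expClock_le_exp_sleExitLevelReal {ω : ℝ≥0 → ℝ} {s : ℝ≥0} (h : sleExitLevel κ n θ ω = s)
    {μ : ℝ} (hμ : 0 ≤ μ) (k : ℝ≥0) :
    expClock κ n θ μ k ω ≤ Real.exp (μ * sleExitLevelReal κ n θ ω) := by
  rw [expClock_apply, sleExitLevelReal_of_eq_coe h, Real.exp_le_exp, h, Process.untopA_min_coe_coe]
  exact mul_le_mul_of_nonneg_left (by exact_mod_cast min_le_right k s) hμ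

/-- `e^{μ σₙ} ≤ e^{μ T}` for `μ ≥ 0` and finite `T`. [folklore] -/
theorem exp_sleExitLevelReal_le_exp_sleLifetimeReal {ω : ℝ≥0 → ℝ} (hT : sleLifetime κ θ ω < ⊤)
    {μ : ℝ} (hμ : 0 ≤ μ) (n : ℕ) :
    Real.exp (μ * sleExitLevelReal κ n θ ω) ≤ Real.exp (μ * sleLifetimeReal κ θ ω) := by
  obtain ⟨t₀, ht₀⟩ := WithTop.ne_top_iff_exists.1 hT.ne
  have hσle := exitLevel_le_lifetime (continuous_sleDriving' κ) n θ ω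
  have hσne : sleExitLevel κ n θ ω ≠ ⊤ := (hσle.trans_lt hT).ne
  obtain ⟨s, hs⟩ := WithTop.ne_top_iff_exists.1 hσne
  rw [sleExitLevelReal_of_eq_coe hs.symm, sleLifetimeReal_of_eq_coe ht₀.symm, Real.exp_le_exp]
  refine mul_le_mul_of_nonneg_left ?_ hμ
  change sleExitLevel κ n θ ω ≤ sleLifetime κ θ ω at hσle
  rw [← hs, ← ht₀, WithTop.coe_le_coe] at hσle
  exact_mod_cast hσle

/-! ### Global `C²` versions of the eigenfunction -/

/-- A global `C²` function agreeing with `H = sin(·/4)^q` near `[2δₙ, 2π - 2δₙ]`. [folklore] -/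
theorem exists_contDiff_lswEigen (κ : ℝ≥0) (n : ℕ) :
    ∃ F : ℝ → ℝ, ContDiff ℝ 2 F ∧ ∀ y ∈ Ioo (level n) (2 * Real.pi - level n), F =ᶠ[𝓝 y] lswEigen κ :=
  exists_contDiff_eventuallyEq (contDiffOn_lswEigen κ) (level_pos n) (level_lt_pi n)

/-! ### Step 1: optional stopping at `σₙ` -/

/-- **`E[e^{λ σₙ} H(Y_{σₙ})] = H(θ)`** for every level `n` whose interval contains `θ` (`κ > 4`):
optional stopping of the eigenfunction martingale at `t ∧ σₙ` and dominated convergence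
`t → ∞` (`σₙ < ∞` a.s., domination by `e^{λT}`). [cite: Lawler2005, §1.11 Lemma 1.31] -/
theorem integral_exp_mul_lswEigen_sleExitLevelValue (hκ : 4 < κ)
    (hθn : θ ∈ Ioo (2 * level n) (2 * Real.pi - 2 * level n)) :
    ∫ ω, Real.exp (lswLambda κ * sleExitLevelReal κ n θ ω) * lswEigen κ (sleExitLevelValue κ n θ ω)
      ∂preWienerMeasure = lswEigen κ θ := by
  haveI := isProbabilityMeasure_preWienerMeasure'
  have hκ' : (4 : ℝ) < κ := by exact_mod_cast hκ
  have hκ0 : κ ≠ 0 := by rintro rfl; exact absurd hκ (by norm_num)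
  have hlam0 : 0 ≤ lswLambda (κ : ℝ) := (lswLambda_pos hκ').le
  obtain ⟨F, hF, hFeq⟩ := exists_contDiff_lswEigen κ n
  have hFval : ∀ y ∈ Icc (2 * level n) (2 * Real.pi - 2 * level n), F y = lswEigen κ y :=
    fun y hy ↦ (hFeq y (Icc_level_subset_Ioo_level n hy)).eq_of_nhds
  have hgen : ∀ y ∈ Icc (2 * level n) (2 * Real.pi - 2 * level n),
      expGenerator κ (lswLambda κ) F y = 0 := by
    intro y hy
    rw [expGenerator_congr (hFeq y (Icc_level_subset_Ioo_level n hy))]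
    exact expGenerator_lswEigen hκ0 (Icc_level_subset_Ioo n hy)
  have hθmem : θ ∈ Icc (2 * level n) (2 * Real.pi - 2 * level n) := ⟨hθn.1.le, hθn.2.le⟩
  -- `∫ e^{λ(k∧σ)} F(V_k) = F θ = H θ` for all `k`
  set G : ℕ → (ℝ≥0 → ℝ) → ℝ := fun k ω ↦ expClock κ n θ (lswLambda κ) k ω *
    F (stoppedProcess (sleArgLevel κ n θ) (sleExitLevel κ n θ) k ω) with hG
  have hint : ∀ k : ℕ, ∫ ω, G k ω ∂preWienerMeasure = lswEigen κ θ := by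
    intro k
    rw [← hFval θ hθmem]
    exact integral_expClock_mul_eq_self hθn hF hgen k
  -- pointwise convergence a.e. (eventually constant) and domination
  have hlim : ∀ᵐ ω ∂preWienerMeasure, Tendsto (fun k : ℕ ↦ G k ω) atTop
      (𝓝 (Real.exp (lswLambda κ * sleExitLevelReal κ n θ ω) * lswEigen κ (sleExitLevelValue κ n θ ω))) := by
    filter_upwards [ae_sleExitLevel_lt_top hκ n θ] with ω hω
    obtain ⟨s, hs⟩ := WithTop.ne_top_iff_exists.1 hω.ne
    refine tendsto_const_nhds.congr' ?_
    filter_upwards [eventually_stoppedProcess_eq_sleExitLevelValue hs.symm,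
      eventually_expClock_eq hs.symm (lswLambda κ)] with k hk1 hk2
    simp only [hG, hk1, hk2]
    congr 1
    have hmem : sleExitLevelValue κ n θ ω ∈ Icc (2 * level n) (2 * Real.pi - 2 * level n) := by
      rcases sleExitLevelValue_eq_or hθn hs.symm with h | h <;> rw [h]
      · exact ⟨le_rfl, by have := level_le_one n; linarith [Real.pi_gt_three]⟩
      · exact ⟨by have := level_le_one n; linarith [Real.pi_gt_three], le_rfl⟩
    exact (hFval _ hmem).symm
  have hmeas : ∀ k : ℕ, AEStronglyMeasurable (G k) preWienerMeasure := fun k ↦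
    (measurable_expClock_mul hF (lswLambda κ) k).aestronglyMeasurable
  have hbound : ∀ k : ℕ, ∀ᵐ ω ∂preWienerMeasure,
      ‖G k ω‖ ≤ Real.exp (lswLambda κ * sleLifetimeReal κ θ ω) := by
    intro k
    filter_upwards [ae_sleLifetime_lt_top (θ := θ) hκ] with ω hT
    have hσ : sleExitLevel κ n θ ω < ⊤ :=
      (exitLevel_le_lifetime (continuous_sleDriving' κ) n θ ω).trans_lt hT
    obtain ⟨s, hs⟩ := WithTop.ne_top_iff_exists.1 hσ.ne
    have hVmem := stoppedProcess_sleArgLevel_mem_Icc (κ := κ) hθn (k : ℝ≥0) ω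
    rw [Real.norm_eq_abs, hG]
    simp only
    rw [abs_mul, abs_of_pos (expClock_pos _ _ ω), hFval _ hVmem,
      abs_of_nonneg (lswEigen_nonneg κ (Icc_level_subset_Icc n hVmem))]
    calc expClock κ n θ (lswLambda κ) k ω * lswEigen κ _
        ≤ expClock κ n θ (lswLambda κ) k ω * 1 :=
          mul_le_mul_of_nonneg_left (lswEigen_le_one hκ (Icc_level_subset_Icc n hVmem))
            (expClock_pos _ _ ω).le
      _ ≤ Real.exp (lswLambda κ * sleExitLevelReal κ n θ ω) := by
          rw [mul_one]; exact expClock_le_exp_sleExitLevelReal hs.symm hlam0 k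
      _ ≤ Real.exp (lswLambda κ * sleLifetimeReal κ θ ω) :=
          exp_sleExitLevelReal_le_exp_sleLifetimeReal hT hlam0 n
  have hdct := tendsto_integral_of_dominated_convergence _ hmeas
    (integrable_exp_lswLambda_mul_sleLifetimeReal hκ) hbound hlim
  exact tendsto_nhds_unique hdct (by simp only [hint]; exact tendsto_const_nhds)

/-! ### Step 2: `n → ∞` -/

/-- **`σₙ → T` in `ℝ`** on `{T < ∞}` (the exit times increase to the lifetime). [folklore] -/
theorem tendsto_sleExitLevelReal {ω : ℝ≥0 → ℝ} (hT : sleLifetime κ θ ω < ⊤) :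
    Tendsto (fun n ↦ sleExitLevelReal κ n θ ω) atTop (𝓝 (sleLifetimeReal κ θ ω)) := by
  obtain ⟨t₀, ht₀⟩ := WithTop.ne_top_iff_exists.1 hT.ne
  have hreal := sleLifetimeReal_of_eq_coe ht₀.symm
  -- real values of the finite exit times, monotone and bounded by `t₀`
  have hfin : ∀ n, ∃ s : ℝ≥0, sleExitLevel κ n θ ω = s ∧ s ≤ t₀ := by
    intro n
    have hle : sleExitLevel κ n θ ω ≤ sleLifetime κ θ ω :=
      exitLevel_le_lifetime (continuous_sleDriving' κ) n θ ω
    have hne : sleExitLevel κ n θ ω ≠ ⊤ := (hle.trans_lt hT).ne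
    obtain ⟨s, hs⟩ := WithTop.ne_top_iff_exists.1 hne
    refine ⟨s, hs.symm, ?_⟩
    rw [← hs, ← ht₀, WithTop.coe_le_coe] at hle
    exact hle
  rw [hreal, tendsto_order]
  constructor
  · intro a ha
    -- `a < t₀`: eventually `a < σₙ`
    rcases lt_or_ge a 0 with ha0 | ha0
    · exact Eventually.of_forall fun n ↦ ha0.trans_le (NNReal.coe_nonneg _)
    · have hlt : ((a.toNNReal : ℝ≥0) : WithTop ℝ≥0) < sleLifetime κ θ ω := by
        rw [← ht₀, WithTop.coe_lt_coe, ← NNReal.coe_lt_coe, Real.coe_toNNReal _ ha0]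
        exact ha
      obtain ⟨N, hN⟩ := eventually_lt_exitLevel (continuous_sleDriving' κ) hlt
      filter_upwards [eventually_ge_atTop N] with n hn
      obtain ⟨s, hs, -⟩ := hfin n
      rw [sleExitLevelReal_of_eq_coe hs]
      have h1 : ((a.toNNReal : ℝ≥0) : WithTop ℝ≥0) < sleExitLevel κ n θ ω := hN n hn
      rw [hs, WithTop.coe_lt_coe, ← NNReal.coe_lt_coe, Real.coe_toNNReal _ ha0] at h1
      exact h1
  · intro b hb
    refine Eventually.of_forall fun n ↦ ?_
    obtain ⟨s, hs, hst⟩ := hfin n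
    rw [sleExitLevelReal_of_eq_coe hs]
    exact lt_of_le_of_lt (by exact_mod_cast hst) hb

/-- **The exit value observable converges**: on `{T < ∞}` (start in `(0, 2π)`, `κ > 4`),
`H(Y^{δₙ}(σₙ)) → 𝟙_{Y_T = 2π}` — eventually `H(2π - 2δₙ) → H(2π) = 1` on `ExitsTop`, eventually
`H(2δₙ) → H(0) = 0` on `ExitsBot` (exit dichotomy). [folklore] -/
theorem tendsto_lswEigen_sleExitLevelValue (hκ : 4 < κ) (hθ : θ ∈ Ioo 0 (2 * Real.pi))
    {ω : ℝ≥0 → ℝ} (hT : sleLifetime κ θ ω < ⊤) :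
    Tendsto (fun n ↦ lswEigen κ (sleExitLevelValue κ n θ ω)) atTop
      (𝓝 ((sleExitsTop κ θ).indicator 1 ω)) := by
  have hcont := continuous_lswEigen hκ
  have hfin : ∀ n, ∃ s : ℝ≥0, sleExitLevel κ n θ ω = s := fun n ↦ by
    have hle : sleExitLevel κ n θ ω ≤ sleLifetime κ θ ω :=
      exitLevel_le_lifetime (continuous_sleDriving' κ) n θ ω
    have hne : sleExitLevel κ n θ ω ≠ ⊤ := (hle.trans_lt hT).ne
    obtain ⟨s, hs⟩ := WithTop.ne_top_iff_exists.1 hne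
    exact ⟨s, hs.symm⟩
  have h2lev : Tendsto (fun n : ℕ ↦ 2 * level n) atTop (𝓝 0) := by
    simpa using tendsto_level.const_mul 2
  rcases exitsTop_or_exitsBot (continuous_sleDriving' κ) hθ hT with htop | hbot
  · have hmem : ω ∈ sleExitsTop κ θ := htop
    rw [indicator_of_mem hmem, Pi.one_apply]
    obtain ⟨N, hN⟩ := htop
    have hlimv : Tendsto (fun n : ℕ ↦ 2 * Real.pi - 2 * level n) atTop (𝓝 (2 * Real.pi)) := by
      simpa using tendsto_const_nhds.sub h2lev
    have h := (hcont.tendsto _).comp hlimv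
    rw [lswEigen_two_pi] at h
    refine h.congr' ?_
    filter_upwards [eventually_ge_atTop N] with n hn
    obtain ⟨s, hs⟩ := hfin n
    simp only [Function.comp_apply]
    rw [(topAt_iff_sleExitLevelValue hs).1 (hN n hn)]
  · have hnmem : ω ∉ sleExitsTop κ θ := fun htop ↦
      not_exitsTop_and_exitsBot (continuous_sleDriving' κ) θ ω ⟨htop, hbot⟩
    rw [indicator_of_notMem hnmem]
    obtain ⟨N, hN⟩ := hbot
    have h := (hcont.tendsto _).comp h2lev
    rw [lswEigen_zero hκ] at h
    refine h.congr' ?_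
    filter_upwards [eventually_ge_atTop N] with n hn
    obtain ⟨s, hs⟩ := hfin n
    simp only [Function.comp_apply]
    rw [(botAt_iff_sleExitLevelValue hs).1 (hN n hn)]

/-- **The one-arm identity of the radial Bessel process of SLE_κ**: for `κ > 4`, `θ ∈ (0, 2π)`,
`λ = (κ² - 16)/(32κ)` and `q = (κ - 4)/κ`,

  `E[e^{λ T} ; Y_T = 2π] = sin(θ/4)^q`,

where `T` is the lifetime of `dYₜ = cot(Yₜ/2) dt - √κ dBₜ`, `Y₀ = θ`, and `{Y_T = 2π}` the event
that `Y` leaves `(0, 2π)` through `2π` (LSW's `ν = 1`). This is the exact form, at the level of the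
radial Bessel process, of the comparison function identity `Λ H = 0`,
`H(θ, t) = sin(θ/4)^q e^{-λt}`, `H(0, t) = 0`, `∂_θ H(2π, t) = 0` behind LSW's Theorem 1.2/1.3
(p. 7: "Note that `H` also has all these properties"), obtained by the Itô/optional-stopping route
"(but other justifications are also possible)" (p. 7): the stopped eigenfunction martingale
(Lawler (2005), Lemma 1.31 pattern), uniform integrability from the exponential moments of `T`
(`RadialBesselLifetime`), and the exit dichotomy (`RadialBesselExit`). For `κ = 6`:
`E[e^{5T/48}; Y_T = 2π] = sin(θ/4)^{1/3}`. [cite: LawlerSchrammWernerEJP2002, §2 p. 7] -/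
theorem integral_exp_lswLambda_mul_indicator_exitsTop (hκ : 4 < κ) (hθ : θ ∈ Ioo 0 (2 * Real.pi)) :
    ∫ ω, (sleExitsTop κ θ).indicator (fun ω ↦ Real.exp (lswLambda κ * sleLifetimeReal κ θ ω)) ω
      ∂preWienerMeasure = Real.sin (θ / 4) ^ lswQ (κ : ℝ) := by
  haveI := isProbabilityMeasure_preWienerMeasure'
  have hκ' : (4 : ℝ) < κ := by exact_mod_cast hκ
  have hlam0 : 0 ≤ lswLambda (κ : ℝ) := (lswLambda_pos hκ').le
  obtain ⟨N₀, hN₀⟩ := eventually_mem_Ioo_level hθ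
  -- the level observables `hₙ = e^{λσₙ} H(Y^{δₙ}(σₙ))`, with `∫ hₙ = H θ` for `n ≥ N₀`
  set h : ℕ → (ℝ≥0 → ℝ) → ℝ := fun n ω ↦ Real.exp (lswLambda κ * sleExitLevelReal κ (n + N₀) θ ω) *
    lswEigen κ (sleExitLevelValue κ (n + N₀) θ ω) with hh
  have hint : ∀ n, ∫ ω, h n ω ∂preWienerMeasure = lswEigen κ θ := fun n ↦
    integral_exp_mul_lswEigen_sleExitLevelValue hκ (hN₀ (n + N₀) (Nat.le_add_left _ _))
  -- a.e. convergence to `e^{λT} 𝟙_{Y_T = 2π}`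
  have hlim : ∀ᵐ ω ∂preWienerMeasure, Tendsto (fun n ↦ h n ω) atTop
      (𝓝 ((sleExitsTop κ θ).indicator (fun ω ↦ Real.exp (lswLambda κ * sleLifetimeReal κ θ ω)) ω)) := by
    filter_upwards [ae_sleLifetime_lt_top (θ := θ) hκ] with ω hT
    have h1 : Tendsto (fun n : ℕ ↦ Real.exp (lswLambda κ * sleExitLevelReal κ (n + N₀) θ ω)) atTop
        (𝓝 (Real.exp (lswLambda κ * sleLifetimeReal κ θ ω))) :=
      ((Real.continuous_exp.tendsto _).comp (((tendsto_sleExitLevelReal hT).comp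
        (tendsto_add_atTop_nat N₀)).const_mul _))
    have h2 : Tendsto (fun n : ℕ ↦ lswEigen κ (sleExitLevelValue κ (n + N₀) θ ω)) atTop
        (𝓝 ((sleExitsTop κ θ).indicator 1 ω)) :=
      (tendsto_lswEigen_sleExitLevelValue hκ hθ hT).comp (tendsto_add_atTop_nat N₀)
    have h3 := h1.mul h2
    have heq : (sleExitsTop κ θ).indicator (fun ω ↦ Real.exp (lswLambda κ * sleLifetimeReal κ θ ω)) ω =
        Real.exp (lswLambda κ * sleLifetimeReal κ θ ω) * (sleExitsTop κ θ).indicator 1 ω := by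
      by_cases hω : ω ∈ sleExitsTop κ θ
      · rw [indicator_of_mem hω, indicator_of_mem hω, Pi.one_apply, mul_one]
      · rw [indicator_of_notMem hω, indicator_of_notMem hω, mul_zero]
    rw [heq]
    exact h3
  -- measurability: each `hₙ` is the a.e. limit of the measurable stage-one observables
  have hmeas : ∀ n, AEStronglyMeasurable (h n) preWienerMeasure := by
    intro n
    set m := n + N₀ with hm
    have hθm := hN₀ m (Nat.le_add_left _ _)
    obtain ⟨F, hF, hFeq⟩ := exists_contDiff_lswEigen κ m
    have hFval : ∀ y ∈ Icc (2 * level m) (2 * Real.pi - 2 * level m), F y = lswEigen κ y :=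
      fun y hy ↦ (hFeq y (Icc_level_subset_Ioo_level m hy)).eq_of_nhds
    refine aestronglyMeasurable_of_tendsto_ae atTop
      (f := fun (k : ℕ) ω ↦ expClock κ m θ (lswLambda κ) k ω *
        F (stoppedProcess (sleArgLevel κ m θ) (sleExitLevel κ m θ) k ω))
      (fun k ↦ (measurable_expClock_mul hF (lswLambda κ) k).aestronglyMeasurable) ?_
    filter_upwards [ae_sleExitLevel_lt_top hκ m θ] with ω hω
    obtain ⟨s, hs⟩ := WithTop.ne_top_iff_exists.1 hω.ne
    refine tendsto_const_nhds.congr' ?_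
    filter_upwards [eventually_stoppedProcess_eq_sleExitLevelValue hs.symm,
      eventually_expClock_eq hs.symm (lswLambda κ)] with k hk1 hk2
    simp only [hh, hk1, hk2]
    congr 1
    have hmem : sleExitLevelValue κ m θ ω ∈ Icc (2 * level m) (2 * Real.pi - 2 * level m) := by
      rcases sleExitLevelValue_eq_or hθm hs.symm with h | h <;> rw [h]
      · exact ⟨le_rfl, by have := level_le_one m; linarith [Real.pi_gt_three]⟩
      · exact ⟨by have := level_le_one m; linarith [Real.pi_gt_three], le_rfl⟩
    exact (hFval _ hmem).symm
  -- domination by `e^{λT}`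
  have hbound : ∀ n, ∀ᵐ ω ∂preWienerMeasure, ‖h n ω‖ ≤ Real.exp (lswLambda κ * sleLifetimeReal κ θ ω) := by
    intro n
    filter_upwards [ae_sleLifetime_lt_top (θ := θ) hκ] with ω hT
    have hσ : sleExitLevel κ (n + N₀) θ ω < ⊤ :=
      (exitLevel_le_lifetime (continuous_sleDriving' κ) (n + N₀) θ ω).trans_lt hT
    obtain ⟨s, hs⟩ := WithTop.ne_top_iff_exists.1 hσ.ne
    have hmem := sleExitLevelValue_mem_Icc (hN₀ (n + N₀) (Nat.le_add_left _ _)) hs.symm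
    rw [Real.norm_eq_abs, hh]
    simp only
    rw [abs_mul, Real.abs_exp, abs_of_nonneg (lswEigen_nonneg κ hmem)]
    calc Real.exp (lswLambda κ * sleExitLevelReal κ (n + N₀) θ ω) * lswEigen κ _
        ≤ Real.exp (lswLambda κ * sleExitLevelReal κ (n + N₀) θ ω) * 1 :=
          mul_le_mul_of_nonneg_left (lswEigen_le_one hκ hmem) (Real.exp_pos _).le
      _ ≤ Real.exp (lswLambda κ * sleLifetimeReal κ θ ω) := by
          rw [mul_one]; exact exp_sleExitLevelReal_le_exp_sleLifetimeReal hT hlam0 _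
  have hdct := tendsto_integral_of_dominated_convergence _ hmeas
    (integrable_exp_lswLambda_mul_sleLifetimeReal hκ) hbound hlim
  have := tendsto_nhds_unique hdct (by simp only [hint]; exact tendsto_const_nhds)
  rw [this, lswEigen]

/-- **`κ = 6`: `E[e^{5T/48}; Y_T = 2π] = sin(θ/4)^{1/3}`** — the one-arm exponent `5/48` and LSW's
`q = 1/3` at the level of the radial Bessel process of SLE₆.
[cite: LawlerSchrammWernerEJP2002, Thm. 1.1 and §2 p. 7] -/
theorem integral_exp_mul_indicator_exitsTop_six (hθ : θ ∈ Ioo 0 (2 * Real.pi)) :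
    ∫ ω, (sleExitsTop 6 θ).indicator (fun ω ↦ Real.exp (5 / 48 * sleLifetimeReal 6 θ ω)) ω
      ∂preWienerMeasure = Real.sin (θ / 4) ^ (1 / 3 : ℝ) := by
  have h := integral_exp_lswLambda_mul_indicator_exitsTop (κ := 6) (by norm_num) hθ
  have h1 : lswLambda ((6 : ℝ≥0) : ℝ) = 5 / 48 := by
    rw [show ((6 : ℝ≥0) : ℝ) = 6 by norm_num]; exact Literature.Probability.Percolation.lswLambda_six
  have h2 : lswQ ((6 : ℝ≥0) : ℝ) = 1 / 3 := by
    rw [show ((6 : ℝ≥0) : ℝ) = 6 by norm_num]; exact Literature.Probability.Percolation.lswQ_six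
  rw [h1, h2] at h
  exact h

end RadialLoewner

end Literature.Probability.RandomPlanarGeometry
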